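import Summits.ResolutionOfSingularities.ResolutionOfSingularities.Theorems.HilbertSamuelEliminationSigmaMaxModificationsCorridor3SigmaIsoDefs
import Summits.ResolutionOfSingularities.ResolutionOfSingularities.Theorems.HilbertSamuelEliminationSigmaMaxModificationsCorridor3SigmaBoundaryRuns
import HarnessLib

/-!
# [OURS · L1 W4.2] σ-LAYER — `Corridor3SigmaIsoBoundaryDefs`: the ISOLATION rows, the extraction row and the two D17 laws FOR A
# BOUNDARY-READING STRATEGY `σ : StrategyE` (E-THREADED typing convention of res-L1-w42-plan-1 RULING v3.14-12a (BR-10) 2026-08-27T10:24:54Z;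
# W4.2 DEAL D16-σ «ISOLATED ROWS ARE STRATEGY-FREE», RULINGS v3.14-11a (CP); crux chain w42 `SigmaMaxModificationsCorridor3`
# stmt-ResolutionOfSingularities-19249 / crux stmt-…-18506; `--supports stmt-ResolutionOfSingularities-19249 --as helper`, counted 0)

HONEST FRAMING. OURS bookkeeping vocabulary over res-L1-type-o1's boundary-threaded σ-state (`…Corridor3SigmaBoundaryDefs`, p523041: `StrategyE`,
`MarkedStageE`, `CanonicalNearStepσE`, `ReachesσE`, `MarkedStageE.IsBlownUpσE`, `InScopeMσE … E₀`, `MaxOriginNoMovingNearChainAtQσE`, `WtopEvNonIsoMσE`,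
`StrategyE.ReachableState`, `IsAdmissibleStrategyOnE`) and res-D-pv-047's `…SigmaBoundaryRuns` (p523856, chain lifts); NOTHING here is a statement of
H. Hironaka's manuscript [Hironaka2017] nor of Cossart–Jannsen–Saito; nothing is asserted beyond definitional unfoldings and chain projections /
lifts. WHY (RULING (BR-10)): the hybrid `ω_ρ`-run of `stub_Wtop_elimination` READS the accumulated boundary `E` — it is a `StrategyE`, not a blind
lift — so the strategy-quantified isolation rows it consumes must be typed over the E-threaded state; the rows below are E-GENERIC (the grades `ē ≥ 3`
and the isolation predicate `Moving.Iso` read only the underlying marked stage) and carry o1's initial-boundary assignment `E₀` (scheme-side default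
`fun _ _ => []`). Every definition is the E-COPY — VERBATIM except `σ.step … s.P C P'` ↦ `σ.step … s.P s.E C P'`, chains of `MarkedStageE`, start
`MarkedStageE.init X x (E₀ X x)` — of res-type-012's BLIND σ-row in `…Corridor3SigmaIsoDefs` (p523704), which in turn is the σ-copy of the landed
CJS rows (p496136, p500943, p517919, p517090, p518912). The BLIND rows are recovered both ways: `…σE_of_withBoundary` (blind row ⇒ E-row of the
blind lift `σ.withBoundary`, every `E₀` — o1's projection lemmas) and `…σ_of_withBoundary` (E-row of `σ.withBoundary` at ANY ONE `E₀` ⇒ blind row —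
chain LIFTING, `exists_chain_liftE` below), so at `σ := (Strategy.cjs R).withBoundary` the landed CJS rows — in particular the v8.2 pointed stub
`WtopRecIsoM p QPointed` and p521299's closer — are recovered through `…Corridor3SigmaIsoDefs`' `Iff.rfl` transports. AI-written; AI review is weaker
than expert review.

## Contents (namespace `…Theorems.SigmaMaxModificationsCorridor3.Sigma`)

* §1 functionals `NoMovingRecurrentNearChainFromσE`, `NoMovingAlternatingNearChainFromσE`; origin rows `MaxOriginNoMovingRecurrentNearChainAtQσE`,
  `MaxOriginNoMovingAlternatingNearChainAtQσE`; the 2 × 2 + ALT at level `3`, grade `ē ≥ 3`: `WtopEvIsoMσE`, `WtopRecNonIsoMσE`, `WtopRecIsoMσE`,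
  `WtopAltMσE` (`WtopEvNonIsoMσE` is o1's).
* §2 the extraction row `IsoTailTowerExtractionMσE σ p E₀`; the laws `StepProjectionσE`, `IsoTransitionLaw3σE σ p Q E₀`, `NoRecurrentIsoPointBirth3σE σ p Q E₀`.
* §3 BLIND ⇒ E-THREADED transports at `σ.withBoundary` (projection).
* §4 E-THREADED ⇒ BLIND transports at `σ.withBoundary` (chain lifting `exists_chain_liftE`).

## References (context only)

* V. Cossart, U. Jannsen, S. Saito, LNM 2270 (2020), Rem. 6.29 (1), Def. 6.34, Def. 6.38, Thm. 6.35, Thm. 6.40. [CossartJannsenSaito2020]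
* J. Kollár, *Lectures on Resolution of Singularities* (2007), Def. 3.65–3.66 (boundaries). [Kollar2007]
-/

noncomputable section

set_option linter.dupNamespace false -- mandated namespace of this single-conjunct summit

open CategoryTheory AlgebraicGeometry TopologicalSpace
open Summit.ResolutionOfSingularities.ResolutionOfSingularities.Theorems.CampaignW42
open Literature.AlgebraicGeometry.Resolution Literature.RingTheory.HilbertSamuel
open Literature.AlgebraicGeometry.CossartJannsenSaito2020
open Summit.ResolutionOfSingularities.ResolutionOfSingularities.Theorems.SigmaMaxModificationsCorridor3.Moving
open Summit.ResolutionOfSingularities.ResolutionOfSingularities.Cruxes.SigmaMaxModifications.IdeasL1Idea2R4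

namespace Summit.ResolutionOfSingularities.ResolutionOfSingularities.Theorems.SigmaMaxModificationsCorridor3.Sigma

universe u

/-! ## §1. The recurrent / alternating moving functionals and the isolation rows, boundary threaded -/

/-- [OURS · L1 W4.2] «No MOVING σ-near `G`-chain from `s₀` visiting `B` infinitely often», for a BOUNDARY-READING `σ` — E-copy of
`NoMovingRecurrentNearChainFromσ` (p523704); grades `G`, `B` read on the underlying marked stage. NOT a statement of the manuscript. [folklore] -/
def NoMovingRecurrentNearChainFromσE (σ : StrategyE.{u}) (N : ℕ) (ν : ℕ → ℕ) (s₀ : MarkedStageE.{u})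
    (G B : MarkedStage.{u} → Prop) : Prop :=
  ¬ ∃ c : ℕ → MarkedStageE.{u}, ReachesσE σ N ν s₀ (c 0) ∧ (∀ n, CanonicalNearStepσE σ N ν (c n) (c (n + 1))) ∧
      (∀ n, G (c n).toMarkedStage) ∧ (∀ n, ∃ m, n ≤ m ∧ (c m).IsBlownUpσE σ N ν) ∧ ∀ n, ∃ m, n ≤ m ∧ B (c m).toMarkedStage

/-- [OURS · L1 W4.2] «No MOVING σ-near `G`-chain from `s₀` that visits `B` infinitely often AND leaves `B` infinitely often» (ALTERNATING), for a
boundary-reading `σ` — E-copy of `NoMovingAlternatingNearChainFromσ` (p523704). NOT a statement of the manuscript. [folklore] -/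
def NoMovingAlternatingNearChainFromσE (σ : StrategyE.{u}) (N : ℕ) (ν : ℕ → ℕ) (s₀ : MarkedStageE.{u})
    (G B : MarkedStage.{u} → Prop) : Prop :=
  ¬ ∃ c : ℕ → MarkedStageE.{u}, ReachesσE σ N ν s₀ (c 0) ∧ (∀ n, CanonicalNearStepσE σ N ν (c n) (c (n + 1))) ∧
      (∀ n, G (c n).toMarkedStage) ∧ (∀ n, ∃ m, n ≤ m ∧ (c m).IsBlownUpσE σ N ν) ∧
      (∀ n, ∃ m, n ≤ m ∧ B (c m).toMarkedStage) ∧ ∀ n, ∃ m, n ≤ m ∧ ¬ B (c m).toMarkedStage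

/-- [OURS · L1 W4.2] **The moving-RECURRENT row at `Q`-origins for a boundary-reading `σ`**, started with the initial-boundary assignment `E₀` —
E-copy of `MaxOriginNoMovingRecurrentNearChainAtQσ` (p523704). NOT a statement of the manuscript. [folklore] -/
def MaxOriginNoMovingRecurrentNearChainAtQσE (σ : StrategyE.{u}) (p N : ℕ) (Q : ℕ → (ℕ → ℕ) → ∀ X : Scheme.{u}, X → Prop)
    (E₀ : ∀ (X : Scheme.{u}), X → Boundary X) (G B : MarkedStage.{u} → Prop) : Prop :=
  ∀ (ν : ℕ → ℕ) (X : Scheme.{u}) [IsLocallyNoetherian X] (x : X), IsMaximalOrigin p N ν X x → Q N ν X x →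
    NoMovingRecurrentNearChainFromσE σ N ν (MarkedStageE.init X x (E₀ X x)) G B

/-- [OURS · L1 W4.2] **The moving-ALTERNATING row at `Q`-origins for a boundary-reading `σ`**, started with `E₀` — E-copy of
`MaxOriginNoMovingAlternatingNearChainAtQσ` (p523704). NOT a statement of the manuscript. [folklore] -/
def MaxOriginNoMovingAlternatingNearChainAtQσE (σ : StrategyE.{u}) (p N : ℕ) (Q : ℕ → (ℕ → ℕ) → ∀ X : Scheme.{u}, X → Prop)
    (E₀ : ∀ (X : Scheme.{u}), X → Boundary X) (G B : MarkedStage.{u} → Prop) : Prop :=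
  ∀ (ν : ℕ → ℕ) (X : Scheme.{u}) [IsLocallyNoetherian X] (x : X), IsMaximalOrigin p N ν X x → Q N ν X x →
    NoMovingAlternatingNearChainFromσE σ N ν (MarkedStageE.init X x (E₀ X x)) G B

/-- [OURS · L1 W4.2] **Ev-Iso for a boundary-reading `σ`** (E-copy of `WtopEvIsoMσ`): no moving σ-chain of grade `ē ≥ 3`, from a stage σ-reachable
from a `Q`-maximal origin of characteristic `p` at level `3` started with `E₀`, ALL of whose stages are isolated in the Hilbert–Samuel locus. For
admissible functional σ it follows from the strategy-free KERNEL (`Sigma.wtopEvIsoMσE_of_admissible`). NOT a statement of the manuscript.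
[cite: CossartJannsenSaito2020, Def. 6.38, Thm. 6.40 (pointers)] -/
def WtopEvIsoMσE (σ : StrategyE.{u}) (p : ℕ) (Q : ℕ → (ℕ → ℕ) → ∀ X : Scheme.{u}, X → Prop)
    (E₀ : ∀ (X : Scheme.{u}), X → Boundary X) : Prop :=
  MaxOriginNoMovingNearChainAtQσE σ p 3 Q E₀ fun s => 3 ≤ s.geomDirDim ∧ Iso 3 s

/-- [OURS · L1 W4.2] **Rec-NonIso for a boundary-reading `σ`** (E-copy of `WtopRecNonIsoMσ`): no moving σ-chain of grade `ē ≥ 3` from a `Q`-maximal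
origin started with `E₀` that is NON-isolated infinitely often. NOT a statement of the manuscript. [cite: CossartJannsenSaito2020, Thm. 6.35 (pointer)] -/
def WtopRecNonIsoMσE (σ : StrategyE.{u}) (p : ℕ) (Q : ℕ → (ℕ → ℕ) → ∀ X : Scheme.{u}, X → Prop)
    (E₀ : ∀ (X : Scheme.{u}), X → Boundary X) : Prop :=
  MaxOriginNoMovingRecurrentNearChainAtQσE σ p 3 Q E₀ (fun s => 3 ≤ s.geomDirDim) fun s => ¬ Iso 3 s

/-- [OURS · L1 W4.2] **Rec-Iso for a boundary-reading `σ`** (E-copy of `WtopRecIsoMσ`; at `Q = QPointed` the E-threaded form of the v8.2 pointed stub's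
row): no moving σ-chain of grade `ē ≥ 3` from a `Q`-maximal origin started with `E₀` that is ISOLATED in the Hilbert–Samuel locus infinitely often. Its
pointed closers are `Sigma.wtopRecIsoMσE_pointed_of_kernel` / `…_of_admissible` / `…_of_admissible_of_birthLaw`. NOT a statement of the manuscript.
[cite: CossartJannsenSaito2020, Def. 6.39, Thm. 6.40 (pointers)] -/
def WtopRecIsoMσE (σ : StrategyE.{u}) (p : ℕ) (Q : ℕ → (ℕ → ℕ) → ∀ X : Scheme.{u}, X → Prop)
    (E₀ : ∀ (X : Scheme.{u}), X → Boundary X) : Prop :=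
  MaxOriginNoMovingRecurrentNearChainAtQσE σ p 3 Q E₀ (fun s => 3 ≤ s.geomDirDim) fun s => Iso 3 s

/-- [OURS · L1 W4.2] **ALT for a boundary-reading `σ`** (E-copy of `WtopAltMσ`): no moving σ-chain of grade `ē ≥ 3` from a `Q`-maximal origin started
with `E₀` that is isolated infinitely often AND non-isolated infinitely often. OPEN content as for the CJS row (σ-transition law — a theorem for
admissible σ — and the σ-birth law). NOT a statement of the manuscript. [cite: CossartJannsenSaito2020, Thm. 6.35, Thm. 6.40 (pointers)] -/
def WtopAltMσE (σ : StrategyE.{u}) (p : ℕ) (Q : ℕ → (ℕ → ℕ) → ∀ X : Scheme.{u}, X → Prop)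
    (E₀ : ∀ (X : Scheme.{u}), X → Boundary X) : Prop :=
  MaxOriginNoMovingAlternatingNearChainAtQσE σ p 3 Q E₀ (fun s => 3 ≤ s.geomDirDim) fun s => Iso 3 s

/-! ## §2. The extraction row and the D17 laws, boundary threaded -/

/-- [OURS · L1 W4.2] **Isolated-tail tower extraction for a boundary-reading `σ`**, started with `E₀` (E-copy of `IsoTailTowerExtractionMσ`, p523704 —
itself the σ-copy of D7's row): a MOVING σ-chain from a maximal origin, all of whose stages are ISOLATED `ē ≥ 3` stages, yields an isolated E3 point
tower (strategy/boundary/label-free) over a maximal origin. PROVED for every admissible functional σ (`Sigma.isoTailTowerExtractionMσE_of_admissible`).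
NOT a statement of the manuscript. [cite: CossartJannsenSaito2020, Def. 6.34, Def. 6.38, Rem. 6.29 (1) (pointers)] -/
def IsoTailTowerExtractionMσE (σ : StrategyE.{u}) (p : ℕ) (E₀ : ∀ (X : Scheme.{u}), X → Boundary X) : Prop :=
  ∀ (ν : ℕ → ℕ) (X : Scheme.{u}) [IsLocallyNoetherian X] (x : X), IsMaximalOrigin p 3 ν X x →
  ∀ c : ℕ → MarkedStageE.{u}, ReachesσE σ 3 ν (MarkedStageE.init X x (E₀ X x)) (c 0) →
    (∀ n, CanonicalNearStepσE σ 3 ν (c n) (c (n + 1))) →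
    (∀ n, 3 ≤ (c n).toMarkedStage.geomDirDim ∧ Iso 3 (c n).toMarkedStage) →
    (∀ n, ∃ m, n ≤ m ∧ (c m).IsBlownUpσE σ 3 ν) →
    ∃ (T : BlowupTower.{u}) (pt : ∀ n, T.X n), IsMaximalOrigin p 3 ν (T.X 0) (pt 0) ∧ IsIsoPointTower 3 ν T pt

/-- [OURS · L1 W4.2] **`f : X_{n+1} ⟶ X_n` is THE BLOW-DOWN of the boundary-threaded σ-step `s → s'`** (E-copy of `StepProjectionσ`, p523704): step data
`(C, P', x')` allowed by σ from the state `(X_n, L, P, E)` of `s`, with `s' = ((Bl_C(X_n), labels updated, P', x'), E.next C)` and `f = π_C` read on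
`s'.W`. NOT a statement of the manuscript. [folklore] -/
def StepProjectionσE (σ : StrategyE.{u}) (N : ℕ) (ν : ℕ → ℕ) (s s' : MarkedStageE.{u}) (f : s'.W ⟶ s.W) : Prop :=
  ∃ (C : s.W.IdealSheafData) (P' : Option (Pending (blowup C))) (h : IsLocallyNoetherian (blowup C))
    (x' : ↥(blowup C)),
    σ.step s.W s.ln N ν s.L s.P s.E C P' ∧ (blowup.π C).base x' = s.pt ∧
      IsClosed ({x'} : Set ↥(blowup C)) ∧ x' ∈ Scheme.hsStratum (blowup C) N ν ∧
      ∃ e : s' = ⟨⟨blowup C, h, s.L.next (Scheme.hsStratum s.W N ν) C, P', x'⟩, s.E.next C⟩,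
        f = eqToHom (congrArg MarkedStage.W (congrArg MarkedStageE.toMarkedStage e)) ≫ blowup.π C

/-- [OURS · L1 W4.2] **THE ISO → NON-ISO TRANSITION LAW for a boundary-reading `σ`**, started with `E₀` (E-copy of `IsoTransitionLaw3σ`, p523704): along
every σ-chain with `3 ≤ ē` from a `Q`-maximal origin, at an iso → non-iso step the blow-down carries an iso point birth through the next marked point
(`IsIsoPointBirthAt`, p517090, read on the underlying marked stages). A THEOREM for every σ admissible on the E-threaded marked scope
(`Sigma.isoTransitionLaw3σE_of_admissible`). NOT a statement of the manuscript. [folklore] -/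
def IsoTransitionLaw3σE (σ : StrategyE.{u}) (p : ℕ) (Q : ℕ → (ℕ → ℕ) → ∀ X : Scheme.{u}, X → Prop)
    (E₀ : ∀ (X : Scheme.{u}), X → Boundary X) : Prop :=
  ∀ (ν : ℕ → ℕ) (X : Scheme.{u}) [IsLocallyNoetherian X] (x : X), IsMaximalOrigin p 3 ν X x → Q 3 ν X x →
  ∀ c : ℕ → MarkedStageE.{u}, ReachesσE σ 3 ν (MarkedStageE.init X x (E₀ X x)) (c 0) →
    (∀ n, CanonicalNearStepσE σ 3 ν (c n) (c (n + 1))) → (∀ n, 3 ≤ (c n).toMarkedStage.geomDirDim) →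
    ∀ n, Iso 3 (c n).toMarkedStage → ¬ Iso 3 (c (n + 1)).toMarkedStage →
      ∃ f : (c (n + 1)).W ⟶ (c n).W, StepProjectionσE σ 3 ν (c n) (c (n + 1)) f ∧
        ∃ Z', IsIsoPointBirthAt 3 ν (c n).toMarkedStage (c (n + 1)).toMarkedStage f Z'

/-- [OURS · L1 W4.2] **NO RECURRENT ISO POINT BIRTHS for a boundary-reading `σ`**, started with `E₀` (E-copy of the conjecture-tagged OURS row
`NoRecurrentIsoPointBirth3σ`, p523704 / res-type-067's `NoRecurrentIsoPointBirth3`, p517090): along every MOVING σ-chain with `3 ≤ ē` from a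
`Q`-maximal origin, from some stage on no σ-step carries an iso point birth through the chain point. OPEN (OURS claim) — THE conjecture-tagged binder
of the E-threaded pointed σ-closer; refutable by ONE σ-chain with infinitely many iso → non-iso transitions. NOT a statement of the manuscript. -/
def NoRecurrentIsoPointBirth3σE (σ : StrategyE.{u}) (p : ℕ) (Q : ℕ → (ℕ → ℕ) → ∀ X : Scheme.{u}, X → Prop)
    (E₀ : ∀ (X : Scheme.{u}), X → Boundary X) : Prop :=
  ∀ (ν : ℕ → ℕ) (X : Scheme.{u}) [IsLocallyNoetherian X] (x : X), IsMaximalOrigin p 3 ν X x → Q 3 ν X x →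
  ∀ c : ℕ → MarkedStageE.{u}, ReachesσE σ 3 ν (MarkedStageE.init X x (E₀ X x)) (c 0) →
    (∀ n, CanonicalNearStepσE σ 3 ν (c n) (c (n + 1))) → (∀ n, 3 ≤ (c n).toMarkedStage.geomDirDim) →
    (∀ n, ∃ m, n ≤ m ∧ (c m).IsBlownUpσE σ 3 ν) →
    ∃ n₁, ∀ n, n₁ ≤ n → ∀ f : (c (n + 1)).W ⟶ (c n).W, StepProjectionσE σ 3 ν (c n) (c (n + 1)) f →
      ∀ Z', ¬ IsIsoPointBirthAt 3 ν (c n).toMarkedStage (c (n + 1)).toMarkedStage f Z'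

/-! ## §3. BLIND ⇒ BOUNDARY-THREADED at `σ.withBoundary` (projection of chains; the direction the rows consume) -/

section BlindToE

variable {σ : Strategy.{u}} {N : ℕ} {ν : ℕ → ℕ}

/-- **ROW TRANSPORT (recurrent functional)**: the blind functional at `s₀.toMarkedStage` gives the threaded one at `s₀` for `σ.withBoundary`. [folklore] -/
theorem noMovingRecurrentNearChainFromσE_of_withBoundary {s₀ : MarkedStageE.{u}} {G B : MarkedStage.{u} → Prop}
    (h : NoMovingRecurrentNearChainFromσ σ N ν s₀.toMarkedStage G B) :
    NoMovingRecurrentNearChainFromσE σ.withBoundary N ν s₀ G B := by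
  rintro ⟨c, h0, hstep, hG, hmov, hio⟩
  refine h ⟨fun n => (c n).toMarkedStage, h0.toMarkedStage, fun n => (hstep n).toMarkedStage, hG, fun n => ?_, hio⟩
  obtain ⟨m, hm, hbu⟩ := hmov n
  exact ⟨m, hm, hbu.toMarkedStage⟩

/-- **ROW TRANSPORT (alternating functional)**. [folklore] -/
theorem noMovingAlternatingNearChainFromσE_of_withBoundary {s₀ : MarkedStageE.{u}} {G B : MarkedStage.{u} → Prop}
    (h : NoMovingAlternatingNearChainFromσ σ N ν s₀.toMarkedStage G B) :
    NoMovingAlternatingNearChainFromσE σ.withBoundary N ν s₀ G B := by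
  rintro ⟨c, h0, hstep, hG, hmov, hio, hioN⟩
  refine h ⟨fun n => (c n).toMarkedStage, h0.toMarkedStage, fun n => (hstep n).toMarkedStage, hG, fun n => ?_, hio, hioN⟩
  obtain ⟨m, hm, hbu⟩ := hmov n
  exact ⟨m, hm, hbu.toMarkedStage⟩

/-- **ROW TRANSPORT at `Q`-origins (recurrent)**, every initial-boundary assignment. [folklore] -/
theorem maxOriginNoMovingRecurrentNearChainAtQσE_of_withBoundary {p : ℕ} {Q : ℕ → (ℕ → ℕ) → ∀ X : Scheme.{u}, X → Prop}
    {G B : MarkedStage.{u} → Prop} (h : MaxOriginNoMovingRecurrentNearChainAtQσ σ p N Q G B) (E₀ : ∀ (X : Scheme.{u}), X → Boundary X) :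
    MaxOriginNoMovingRecurrentNearChainAtQσE σ.withBoundary p N Q E₀ G B :=
  fun ν X _ x hX hQ => noMovingRecurrentNearChainFromσE_of_withBoundary (h ν X x hX hQ)

/-- **ROW TRANSPORT at `Q`-origins (alternating)**. [folklore] -/
theorem maxOriginNoMovingAlternatingNearChainAtQσE_of_withBoundary {p : ℕ} {Q : ℕ → (ℕ → ℕ) → ∀ X : Scheme.{u}, X → Prop}
    {G B : MarkedStage.{u} → Prop} (h : MaxOriginNoMovingAlternatingNearChainAtQσ σ p N Q G B) (E₀ : ∀ (X : Scheme.{u}), X → Boundary X) :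
    MaxOriginNoMovingAlternatingNearChainAtQσE σ.withBoundary p N Q E₀ G B :=
  fun ν X _ x hX hQ => noMovingAlternatingNearChainFromσE_of_withBoundary (h ν X x hX hQ)

/-- Ev-Iso: blind ⇒ threaded at `σ.withBoundary`. [folklore] -/
theorem wtopEvIsoMσE_of_withBoundary {p : ℕ} {Q : ℕ → (ℕ → ℕ) → ∀ X : Scheme.{u}, X → Prop} (h : WtopEvIsoMσ σ p Q)
    (E₀ : ∀ (X : Scheme.{u}), X → Boundary X) : WtopEvIsoMσE σ.withBoundary p Q E₀ :=
  maxOriginNoMovingNearChainAtQσE_of_withBoundary h E₀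

/-- Rec-NonIso: blind ⇒ threaded at `σ.withBoundary`. [folklore] -/
theorem wtopRecNonIsoMσE_of_withBoundary {p : ℕ} {Q : ℕ → (ℕ → ℕ) → ∀ X : Scheme.{u}, X → Prop} (h : WtopRecNonIsoMσ σ p Q)
    (E₀ : ∀ (X : Scheme.{u}), X → Boundary X) : WtopRecNonIsoMσE σ.withBoundary p Q E₀ :=
  maxOriginNoMovingRecurrentNearChainAtQσE_of_withBoundary h E₀

/-- Rec-Iso: blind ⇒ threaded at `σ.withBoundary`. [folklore] -/
theorem wtopRecIsoMσE_of_withBoundary {p : ℕ} {Q : ℕ → (ℕ → ℕ) → ∀ X : Scheme.{u}, X → Prop} (h : WtopRecIsoMσ σ p Q)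
    (E₀ : ∀ (X : Scheme.{u}), X → Boundary X) : WtopRecIsoMσE σ.withBoundary p Q E₀ :=
  maxOriginNoMovingRecurrentNearChainAtQσE_of_withBoundary h E₀

/-- ALT: blind ⇒ threaded at `σ.withBoundary`. [folklore] -/
theorem wtopAltMσE_of_withBoundary {p : ℕ} {Q : ℕ → (ℕ → ℕ) → ∀ X : Scheme.{u}, X → Prop} (h : WtopAltMσ σ p Q)
    (E₀ : ∀ (X : Scheme.{u}), X → Boundary X) : WtopAltMσE σ.withBoundary p Q E₀ :=
  maxOriginNoMovingAlternatingNearChainAtQσE_of_withBoundary h E₀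

/-- Extraction: blind ⇒ threaded at `σ.withBoundary` (project the E-chain and extract blindly). [folklore] -/
theorem isoTailTowerExtractionMσE_of_withBoundary {p : ℕ} (h : IsoTailTowerExtractionMσ σ p) (E₀ : ∀ (X : Scheme.{u}), X → Boundary X) :
    IsoTailTowerExtractionMσE σ.withBoundary p E₀ := by
  intro ν X _ x hX c h0 hstep hGI hmov
  refine h ν X x hX (fun n => (c n).toMarkedStage) h0.toMarkedStage (fun n => (hstep n).toMarkedStage) hGI fun n => ?_
  obtain ⟨m, hm, hbu⟩ := hmov n
  exact ⟨m, hm, hbu.toMarkedStage⟩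

end BlindToE

/-! ## §4. BOUNDARY-THREADED ⇒ BLIND at `σ.withBoundary` (lifting of chains: the blind rows, hence the CJS rows, are recovered) -/

section EToBlind

variable {σ : Strategy.{u}} {N : ℕ} {ν : ℕ → ℕ}

/-- **INFINITE CHAINS LIFT**: a chain of blind σ-steps whose start underlies the boundary-threaded marked stage reached from `s₀` lifts to a chain of
boundary-threaded steps of `σ.withBoundary` from `s₀` (o1's one-step lift `CanonicalNearStepσ.exists_liftE` iterated by recursion, the boundary
being prescribed at each step; `Reachesσ.exists_liftE` for the initial segment). [folklore] -/
theorem exists_chain_liftE (s₀ : MarkedStageE.{u}) {c : ℕ → MarkedStage.{u}} (h0 : Reachesσ σ N ν s₀.toMarkedStage (c 0))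
    (hstep : ∀ n, CanonicalNearStepσ σ N ν (c n) (c (n + 1))) :
    ∃ cE : ℕ → MarkedStageE.{u}, (∀ n, (cE n).toMarkedStage = c n) ∧ ReachesσE σ.withBoundary N ν s₀ (cE 0) ∧
      ∀ n, CanonicalNearStepσE σ.withBoundary N ν (cE n) (cE (n + 1)) := by
  classical
  obtain ⟨t₀, ht₀, hreach⟩ := Reachesσ.exists_liftE s₀ h0
  -- the lifted stages, as subtypes over the blind chain
  let St : ℕ → Type (u + 1) := fun n => {s : MarkedStageE.{u} // s.toMarkedStage = c n}
  let st0 : St 0 := ⟨t₀, ht₀⟩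
  let stepFn : ∀ n, St n → St (n + 1) := fun n s =>
    let h := CanonicalNearStepσ.exists_liftE (s := s.1) (t := c (n + 1)) (by rw [s.2]; exact hstep n)
    ⟨h.choose, h.choose_spec.1⟩
  let st : ∀ n, St n := fun n => Nat.rec (motive := St) st0 (fun n s => stepFn n s) n
  refine ⟨fun n => (st n).1, fun n => (st n).2, hreach, fun n => ?_⟩
  exact (CanonicalNearStepσ.exists_liftE (s := (st n).1) (t := c (n + 1)) (by rw [(st n).2]; exact hstep n)).choose_spec.2

/-- **Recurrent functional: threaded at `σ.withBoundary` ⇒ blind** (lift the blind chain). [folklore] -/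
theorem noMovingRecurrentNearChainFromσ_of_withBoundary {s₀ : MarkedStageE.{u}} {G B : MarkedStage.{u} → Prop}
    (h : NoMovingRecurrentNearChainFromσE σ.withBoundary N ν s₀ G B) :
    NoMovingRecurrentNearChainFromσ σ N ν s₀.toMarkedStage G B := by
  rintro ⟨c, h0, hstep, hG, hmov, hio⟩
  obtain ⟨cE, hcE, h0E, hstepE⟩ := exists_chain_liftE s₀ h0 hstep
  refine h ⟨cE, h0E, hstepE, fun n => by rw [hcE]; exact hG n, fun n => ?_, fun n => by simpa only [hcE] using hio n⟩
  obtain ⟨m, hm, hbu⟩ := hmov n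
  exact ⟨m, hm, ((cE m).isBlownUpσE_withBoundary_iff).mpr (by rw [hcE]; exact hbu)⟩

/-- **Alternating functional: threaded at `σ.withBoundary` ⇒ blind**. [folklore] -/
theorem noMovingAlternatingNearChainFromσ_of_withBoundary {s₀ : MarkedStageE.{u}} {G B : MarkedStage.{u} → Prop}
    (h : NoMovingAlternatingNearChainFromσE σ.withBoundary N ν s₀ G B) :
    NoMovingAlternatingNearChainFromσ σ N ν s₀.toMarkedStage G B := by
  rintro ⟨c, h0, hstep, hG, hmov, hio, hioN⟩
  obtain ⟨cE, hcE, h0E, hstepE⟩ := exists_chain_liftE s₀ h0 hstep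
  refine h ⟨cE, h0E, hstepE, fun n => by rw [hcE]; exact hG n, fun n => ?_, fun n => by simpa only [hcE] using hio n,
    fun n => by simpa only [hcE] using hioN n⟩
  obtain ⟨m, hm, hbu⟩ := hmov n
  exact ⟨m, hm, ((cE m).isBlownUpσE_withBoundary_iff).mpr (by rw [hcE]; exact hbu)⟩

/-- **Moving functional: threaded at `σ.withBoundary` ⇒ blind** (the converse of o1's `noMovingNearChainFromσE_of_withBoundary`). [folklore] -/
theorem noMovingNearChainFromσ_of_withBoundary {s₀ : MarkedStageE.{u}} {G : MarkedStage.{u} → Prop}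
    (h : NoMovingNearChainFromσE σ.withBoundary N ν s₀ G) : NoMovingNearChainFromσ σ N ν s₀.toMarkedStage G := by
  rintro ⟨c, h0, hstep, hG, hmov⟩
  obtain ⟨cE, hcE, h0E, hstepE⟩ := exists_chain_liftE s₀ h0 hstep
  refine h ⟨cE, h0E, hstepE, fun n => by rw [hcE]; exact hG n, fun n => ?_⟩
  obtain ⟨m, hm, hbu⟩ := hmov n
  exact ⟨m, hm, ((cE m).isBlownUpσE_withBoundary_iff).mpr (by rw [hcE]; exact hbu)⟩

/-- **ROWS: threaded at `σ.withBoundary` for ONE initial-boundary assignment ⇒ blind.** Rec-Iso. [folklore] -/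
theorem wtopRecIsoMσ_of_withBoundary {p : ℕ} {Q : ℕ → (ℕ → ℕ) → ∀ X : Scheme.{u}, X → Prop} {E₀ : ∀ (X : Scheme.{u}), X → Boundary X}
    (h : WtopRecIsoMσE σ.withBoundary p Q E₀) : WtopRecIsoMσ σ p Q :=
  fun ν X _ x hX hQ => noMovingRecurrentNearChainFromσ_of_withBoundary (s₀ := MarkedStageE.init X x (E₀ X x)) (h ν X x hX hQ)

/-- Rec-NonIso: threaded ⇒ blind. [folklore] -/
theorem wtopRecNonIsoMσ_of_withBoundary {p : ℕ} {Q : ℕ → (ℕ → ℕ) → ∀ X : Scheme.{u}, X → Prop}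
    {E₀ : ∀ (X : Scheme.{u}), X → Boundary X} (h : WtopRecNonIsoMσE σ.withBoundary p Q E₀) : WtopRecNonIsoMσ σ p Q :=
  fun ν X _ x hX hQ => noMovingRecurrentNearChainFromσ_of_withBoundary (s₀ := MarkedStageE.init X x (E₀ X x)) (h ν X x hX hQ)

/-- Ev-Iso: threaded ⇒ blind. [folklore] -/
theorem wtopEvIsoMσ_of_withBoundary {p : ℕ} {Q : ℕ → (ℕ → ℕ) → ∀ X : Scheme.{u}, X → Prop}
    {E₀ : ∀ (X : Scheme.{u}), X → Boundary X} (h : WtopEvIsoMσE σ.withBoundary p Q E₀) : WtopEvIsoMσ σ p Q :=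
  fun ν X _ x hX hQ => noMovingNearChainFromσ_of_withBoundary (s₀ := MarkedStageE.init X x (E₀ X x)) (h ν X x hX hQ)

/-- ALT: threaded ⇒ blind. [folklore] -/
theorem wtopAltMσ_of_withBoundary {p : ℕ} {Q : ℕ → (ℕ → ℕ) → ∀ X : Scheme.{u}, X → Prop}
    {E₀ : ∀ (X : Scheme.{u}), X → Boundary X} (h : WtopAltMσE σ.withBoundary p Q E₀) : WtopAltMσ σ p Q :=
  fun ν X _ x hX hQ => noMovingAlternatingNearChainFromσ_of_withBoundary (s₀ := MarkedStageE.init X x (E₀ X x)) (h ν X x hX hQ)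

/-- **THE CJS ROW IS RECOVERED** (RULING (BR-10) «so `σ := (Strategy.cjs R).withBoundary` still recovers p521299»): the E-threaded Rec-Iso row of the
blind lifts of ALL CJS strategies, at any one `E₀`, gives the registered row `WtopRecIsoM p Q` (through `wtopRecIsoM_iff_forall_cjs`, `Iff.rfl`). [folklore] -/
theorem wtopRecIsoM_of_forall_cjs_withBoundary {p : ℕ} {Q : ℕ → (ℕ → ℕ) → ∀ X : Scheme.{u}, X → Prop}
    (E₀ : ∀ (X : Scheme.{u}), X → Boundary X)
    (h : ∀ (R : ∀ S : Scheme.{u}, CentreSeq S → Prop), OracleFunctional R → OracleAdmissible R →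
      WtopRecIsoMσE (Strategy.cjs R).withBoundary p Q E₀) : WtopRecIsoM.{u} p Q :=
  (wtopRecIsoM_iff_forall_cjs p Q).2 fun R hRf hRa => wtopRecIsoMσ_of_withBoundary (h R hRf hRa)

end EToBlind

end Summit.ResolutionOfSingularities.ResolutionOfSingularities.Theorems.SigmaMaxModificationsCorridor3.Sigma

end
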